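import Summits.QuantumFields.QCD.Theses.QuarksAsStableAction

/-!
# Determinant of the identity plus a weighted block cyclic shift
(helper for crux stmt-QuantumFields-9737, line `Sketch` — F3-core brick: stubs
`det_one_add_blockShift` and `det_blockDiag_add_blockShift`)

This is the generic linear-algebra step of the slice-transfer (Lüscher transfer-matrix /
Fock-trace) reduction of a block-bidiagonal **cyclic** determinant: for blocks
`E_t, F_t ∈ M_k(ℂ)` indexed by `t ∈ ℤ/T` (`T ≥ 1`), the `(ℤ/T × k)`-matrix `D` with diagonal blocks
`E_t` and super-diagonal blocks `F_t` at `(t, t + 1)` (wrapping around) satisfies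
`det D = ∏_t det E_t · det (1 - (-1)^T ∏_t E_t⁻¹ F_t)` (ordered product in increasing time,
`det_blockDiag_add_blockShift`), the core case being `E_t = 1`:
`det (1 + 𝒩) = det (1 - (-1)^T N_0 N_1 ⋯ N_{T-1})` for the weighted block cyclic shift `𝒩` with
blocks `N_t` at `(t, t + 1)` (`det_one_add_blockShift`); `-(-1)^T` is the signature of the
`T`-cycle.  [cite: Luscher1977, pp. 283–292]; folklore in transfer-matrix language (Molinari,
Linear Algebra Appl. 429 (2008) 2221, transfer-matrix identities for block-tridiagonal cyclic
determinants).

Proof (Weinstein–Aronszajn): split `𝒩 = 𝒩' + A B` into its non-wrapping part `𝒩'` (block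
strictly upper triangular for the block index `t.val`, so `det (1 + 𝒩') = 1`) and the corner
`A B` (`A` = last block column carrying `N_{T-1}`, `B` = selector of the first block column); the
explicit block column `Y_t = (-1)^{T-1-t} N_t ⋯ N_{T-1}` solves `(1 + 𝒩') Y = A`, whence
`det (1 + 𝒩) = det (1 + 𝒩') · det (1 + Y B) = det (1 + B Y) = det (1 + (-1)^{T-1} N_0 ⋯ N_{T-1})`.
Block matrices are handled through Mathlib's `Matrix.comp` (a matrix of `k × k` blocks viewed as
a matrix on the product index type), so that all block bookkeeping is ordinary matrix algebra
over the ring `Matrix k k ℂ`.  Pure linear algebra over Mathlib (`Matrix.det_one_add_mul_comm`,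
`Matrix.BlockTriangular.det`, `Matrix.det_blockDiagonal`); pure theorem file (no definitions),
no definition of the tree is used.
-/

noncomputable section

namespace Summit.QuantumFields.QCD.Cruxes.StableActionBridge.Sketch

namespace BlockCyclicDet

/-! ### Block matrices (`Matrix.comp`) with `k × k` blocks -/

section Blocks

variable {k : Type}

/-- Entries of `if c then A else 0`. -/
theorem ite_zero_apply (c : Prop) [Decidable c] (A : Matrix k k ℂ) (i j : k) :
    (if c then A else 0) i j = if c then A i j else 0 := by
  split_ifs <;> rfl

/-- `Matrix.comp` is additive (any shape). -/
theorem comp_add' {ι ι' : Type} (M M' : Matrix ι ι' (Matrix k k ℂ)) :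
    Matrix.comp ι ι' k k ℂ (M + M') = Matrix.comp ι ι' k k ℂ M + Matrix.comp ι ι' k k ℂ M' :=
  Matrix.ext fun _ _ => rfl

section One

variable [DecidableEq k]

/-- The identity plus a `1 × 1` block matrix. -/
theorem one_add_comp_unit (C : Matrix k k ℂ) :
    1 + Matrix.comp Unit Unit k k ℂ (Matrix.of fun _ _ => C) =
      Matrix.comp Unit Unit k k ℂ (Matrix.of fun _ _ => 1 + C) := by
  ext ⟨u, i⟩ ⟨v, j⟩
  obtain rfl : u = v := Subsingleton.elim _ _
  simp only [Matrix.add_apply, Matrix.comp_apply, Matrix.of_apply, Matrix.one_apply,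
    Prod.mk.injEq, true_and]

end One

variable [Fintype k]

/-- `Matrix.comp` is multiplicative (any shapes). -/
theorem comp_mul' {ι₁ ι₂ ι₃ : Type} [Fintype ι₂] (M : Matrix ι₁ ι₂ (Matrix k k ℂ))
    (M' : Matrix ι₂ ι₃ (Matrix k k ℂ)) :
    Matrix.comp ι₁ ι₃ k k ℂ (M * M') = Matrix.comp ι₁ ι₂ k k ℂ M * Matrix.comp ι₂ ι₃ k k ℂ M' := by
  ext p q
  simp only [Matrix.comp_apply, Matrix.mul_apply, Fintype.sum_prod_type, Matrix.sum_apply]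

variable [DecidableEq k]

/-- The determinant of a `1 × 1` block matrix is the determinant of its block. -/
theorem det_comp_unit (C : Matrix k k ℂ) :
    (Matrix.comp Unit Unit k k ℂ (Matrix.of fun _ _ => C)).det = C.det :=
  Matrix.det_submatrix_equiv_self (Equiv.punitProd k) C

/-- The Weinstein–Aronszajn regrouping `1 + U + (1 + U) Y B = (1 + U) (1 + Y B)`. -/
theorem one_add_mul_one_add {m n R : Type} [Fintype m] [Fintype n] [DecidableEq m] [Semiring R]
    (U : Matrix m m R) (Y : Matrix m n R) (B : Matrix n m R) :
    1 + (U + (1 + U) * Y * B) = (1 + U) * (1 + Y * B) := by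
  rw [Matrix.mul_add, Matrix.mul_one, Matrix.mul_assoc, add_assoc]

end Blocks

/-! ### `ZMod T` bookkeeping -/

section ZModVal

variable {T : ℕ} [NeZero T]

/-- `(s + 1).val = (s.val + 1) % T`. -/
theorem val_add_one_eq_mod (s : ZMod T) : (s + 1).val = (s.val + 1) % T := by
  rw [ZMod.val_add, ZMod.val_one_eq_one_mod, Nat.add_mod_mod]

/-- Away from the wrap-around, `val` increases by one. -/
theorem val_add_one_of_ne {s : ZMod T} (h : s + 1 ≠ 0) : (s + 1).val = s.val + 1 := by
  rcases Nat.lt_or_ge (s.val + 1) T with h3 | h3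
  · rw [val_add_one_eq_mod, Nat.mod_eq_of_lt h3]
  · have h4 : s.val + 1 = T := le_antisymm (ZMod.val_lt s) h3
    exact absurd ((ZMod.val_eq_zero _).1 (by rw [val_add_one_eq_mod, h4, Nat.mod_self])) h

/-- At the wrap-around (`s = -1`), `s.val = T - 1`. -/
theorem val_eq_of_add_one_eq_zero {s : ZMod T} (h : s + 1 = 0) : s.val = T - 1 := by
  rcases Nat.lt_or_ge (s.val + 1) T with h3 | h3
  · have h4 := (ZMod.val_eq_zero (s + 1)).2 h
    rw [val_add_one_eq_mod, Nat.mod_eq_of_lt h3] at h4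
    exact absurd h4 (Nat.succ_ne_zero _)
  · have := ZMod.val_lt s
    omega

end ZModVal

/-! ### The Weinstein–Aronszajn factorisation

Block matrices over `Matrix k k ℂ` (all written as literals): the shift `𝒩` has blocks
`if t = s + 1 then N s else 0`, its non-wrapping part `𝒩'` has blocks
`if t = s + 1 ∧ s + 1 ≠ 0 then N s else 0`, the corner column `A` (indexed by `ZMod T × Unit`) is
`if s + 1 = 0 then N s else 0`, the selector row `B` is `if t = 0 then 1 else 0`, and the solution
column is `Y_s = (-1)^(T-1-s.val) • N_s N_{s+1} ⋯ N_{T-1}`, the ordered products being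
`((List.range m).map fun i => N ↑(t + i)).prod`. -/

section Cyclic

variable {T : ℕ} {k : Type} [Fintype k] [DecidableEq k]

/-- Peeling off the first factor of an ordered product `N_t N_{t+1} ⋯ N_{t+m}`. -/
theorem prod_map_range_succ (N : ZMod T → Matrix k k ℂ) (t m : ℕ) :
    ((List.range (m + 1)).map fun i => N ((t + i : ℕ) : ZMod T)).prod =
      N (t : ZMod T) * ((List.range m).map fun i => N ((t + 1 + i : ℕ) : ZMod T)).prod := by
  have h : ((fun i : ℕ => N ((t + i : ℕ) : ZMod T)) ∘ Nat.succ) =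
      fun i : ℕ => N ((t + 1 + i : ℕ) : ZMod T) := by
    funext i
    simp only [Function.comp_apply, Nat.succ_eq_add_one]
    rw [← Nat.add_assoc, Nat.add_right_comm]
  rw [List.range_succ_eq_map, List.map_cons, List.prod_cons, List.map_map, h, Nat.add_zero]

/-- Splitting off the corner: `𝒩 = 𝒩' + A B` (block level). -/
theorem shift_split (N : ZMod T → Matrix k k ℂ) :
    (Matrix.of fun s t : ZMod T => if t = s + 1 then N s else 0) =
      (Matrix.of fun s t : ZMod T => if t = s + 1 ∧ s + 1 ≠ 0 then N s else 0) +
        (Matrix.of fun (s : ZMod T) (_ : Unit) => if s + 1 = 0 then N s else 0) *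
          (Matrix.of fun (_ : Unit) (t : ZMod T) => if t = 0 then (1 : Matrix k k ℂ) else 0) := by
  refine Matrix.ext fun s t => ?_
  simp only [Matrix.add_apply, Matrix.mul_apply, Matrix.of_apply, Finset.univ_unique,
    Finset.sum_singleton]
  by_cases hs : s + 1 = 0
  · simp [hs]
  · simp [hs]

variable [NeZero T]

/-- `(1 + 𝒩') Y = A` (block level). -/
theorem one_add_upper_mul_sol (N : ZMod T → Matrix k k ℂ) :
    ((1 : Matrix (ZMod T) (ZMod T) (Matrix k k ℂ)) +
          Matrix.of fun s t : ZMod T => if t = s + 1 ∧ s + 1 ≠ 0 then N s else 0) *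
        (Matrix.of fun (s : ZMod T) (_ : Unit) => (-1 : ℂ) ^ (T - 1 - s.val) •
          ((List.range (T - s.val)).map fun i => N ((s.val + i : ℕ) : ZMod T)).prod) =
      Matrix.of fun (s : ZMod T) (_ : Unit) => if s + 1 = 0 then N s else 0 := by
  have hT : 0 < T := Nat.pos_of_ne_zero (NeZero.ne T)
  refine Matrix.ext fun s u => ?_
  rw [Matrix.add_mul, Matrix.one_mul]
  simp only [Matrix.add_apply, Matrix.mul_apply, Matrix.of_apply]
  by_cases hs : s + 1 = 0
  · have hv := val_eq_of_add_one_eq_zero hs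
    simp only [hs, ne_eq, not_true_eq_false, and_false, if_false, zero_mul,
      Finset.sum_const_zero, add_zero, if_true]
    rw [show T - 1 - s.val = 0 from by omega, show T - s.val = 0 + 1 from by omega, pow_zero,
      one_smul, prod_map_range_succ, List.range_zero, List.map_nil, List.prod_nil, mul_one,
      ZMod.natCast_zmod_val]
  · have hv := val_add_one_of_ne hs
    have hlt : s.val + 1 < T := hv ▸ ZMod.val_lt (s + 1)
    simp only [hs, ne_eq, not_false_eq_true, and_true, ite_mul, zero_mul, Finset.sum_ite_eq',
      Finset.mem_univ, if_true, if_false]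
    rw [hv, show T - 1 - s.val = T - 1 - (s.val + 1) + 1 from by omega,
      show T - s.val = T - (s.val + 1) + 1 from by omega, prod_map_range_succ,
      ZMod.natCast_zmod_val, pow_succ, mul_neg_one, neg_smul, Matrix.mul_smul, neg_add_cancel]

omit [Fintype k] in
/-- `1 + 𝒩'` is block upper triangular for the block index `t.val`. -/
theorem blockTriangular_one_add_upper (N : ZMod T → Matrix k k ℂ) :
    (1 + Matrix.comp (ZMod T) (ZMod T) k k ℂ
        (Matrix.of fun s t : ZMod T => if t = s + 1 ∧ s + 1 ≠ 0 then N s else 0)).BlockTriangular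
      fun p : ZMod T × k => p.1.val := by
  refine Matrix.blockTriangular_one.add fun p q hpq => ?_
  have hpq' : q.1.val < p.1.val := hpq
  have hne : ¬(q.1 = p.1 + 1 ∧ p.1 + 1 ≠ 0) := by
    rintro ⟨h1, h2⟩
    have h3 := val_add_one_of_ne h2
    rw [← h1] at h3
    omega
  simp only [Matrix.comp_apply, Matrix.of_apply, if_neg hne, Matrix.zero_apply]

/-- `det (1 + 𝒩') = 1` (block unipotent). -/
theorem det_one_add_upper (N : ZMod T → Matrix k k ℂ) :
    (1 + Matrix.comp (ZMod T) (ZMod T) k k ℂ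
        (Matrix.of fun s t : ZMod T => if t = s + 1 ∧ s + 1 ≠ 0 then N s else 0)).det = 1 := by
  rw [(blockTriangular_one_add_upper N).det]
  refine Finset.prod_eq_one fun a _ => ?_
  rw [show (1 + Matrix.comp (ZMod T) (ZMod T) k k ℂ
      (Matrix.of fun s t : ZMod T => if t = s + 1 ∧ s + 1 ≠ 0 then N s else 0)).toSquareBlock
      (fun p : ZMod T × k => p.1.val) a = 1 from ?_, Matrix.det_one]
  ext ⟨p, hp⟩ ⟨q, hq⟩
  have hne : ¬(q.1 = p.1 + 1 ∧ p.1 + 1 ≠ 0) := by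
    rintro ⟨h1, h2⟩
    have h3 := val_add_one_of_ne h2
    rw [← h1] at h3
    have hp' : p.1.val = a := hp
    have hq' : q.1.val = a := hq
    omega
  simp only [Matrix.toSquareBlock_def, Matrix.of_apply, Matrix.add_apply, Matrix.comp_apply,
    if_neg hne, Matrix.zero_apply, add_zero, Matrix.one_apply, Subtype.mk.injEq]

/-- `B Y` is the `1 × 1` block matrix `(-1)^{T-1} N_0 ⋯ N_{T-1}` (block level). -/
theorem sel_mul_sol (N : ZMod T → Matrix k k ℂ) :
    (Matrix.of fun (_ : Unit) (t : ZMod T) => if t = 0 then (1 : Matrix k k ℂ) else 0) *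
        (Matrix.of fun (s : ZMod T) (_ : Unit) => (-1 : ℂ) ^ (T - 1 - s.val) •
          ((List.range (T - s.val)).map fun i => N ((s.val + i : ℕ) : ZMod T)).prod) =
      Matrix.of fun _ _ : Unit =>
        (-1 : ℂ) ^ (T - 1) • ((List.range T).map fun i : ℕ => N (i : ZMod T)).prod := by
  refine Matrix.ext fun u v => ?_
  simp only [Matrix.mul_apply, Matrix.of_apply, ite_mul, one_mul, zero_mul, Finset.sum_ite_eq',
    Finset.mem_univ, if_true, ZMod.val_zero, Nat.sub_zero, Nat.zero_add]

/-- **Main lemma, block form**: `det (1 + 𝒩) = det (1 - (-1)^T N_0 ⋯ N_{T-1})`. -/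
theorem det_one_add_comp_shift (N : ZMod T → Matrix k k ℂ) :
    (1 + Matrix.comp (ZMod T) (ZMod T) k k ℂ
        (Matrix.of fun s t : ZMod T => if t = s + 1 then N s else 0)).det =
      (1 - (-1 : ℂ) ^ T • ((List.range T).map fun i : ℕ => N (i : ZMod T)).prod).det := by
  rw [shift_split, ← one_add_upper_mul_sol N, comp_add', comp_mul', comp_mul', comp_add',
    Matrix.comp_one, one_add_mul_one_add, Matrix.det_mul, det_one_add_upper, one_mul,
    Matrix.det_one_add_mul_comm, ← comp_mul', sel_mul_sol, one_add_comp_unit, det_comp_unit]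
  congr 1
  obtain ⟨n, rfl⟩ := Nat.exists_eq_add_one_of_ne_zero (NeZero.ne T)
  rw [Nat.add_sub_cancel, pow_succ, mul_neg_one, neg_smul, sub_neg_eq_add]

/-! ### The block diagonal factor -/

/-- `det (blockdiag E) = ∏_t det E_t` (via Mathlib's `blockDiagonal`, index factors swapped). -/
theorem det_comp_diag (E : ZMod T → Matrix k k ℂ) :
    (Matrix.comp (ZMod T) (ZMod T) k k ℂ
        (Matrix.of fun s t : ZMod T => if t = s then E s else 0)).det = ∏ t, (E t).det := by
  have h : Matrix.comp (ZMod T) (ZMod T) k k ℂ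
      (Matrix.of fun s t : ZMod T => if t = s then E s else 0) =
      Matrix.reindex (Equiv.prodComm _ _) (Equiv.prodComm _ _) (Matrix.blockDiagonal E) := by
    ext ⟨s, i⟩ ⟨t, j⟩
    simp only [Matrix.comp_apply, Matrix.of_apply, Matrix.reindex_apply, Matrix.submatrix_apply,
      Equiv.prodComm_symm, Equiv.prodComm_apply, Prod.swap_prod_mk, Matrix.blockDiagonal_apply']
    by_cases hts : t = s
    · subst hts
      simp
    · simp [hts, Ne.symm hts]
  rw [h, Matrix.det_reindex_self, Matrix.det_blockDiagonal]

/-- `blockdiag E · (1 + 𝒩[E⁻¹ F]) = blockdiag E + 𝒩[F]` for blockwise invertible `E`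
(block level). -/
theorem diag_mul_one_add_shift (E F : ZMod T → Matrix k k ℂ) (hE : ∀ t, IsUnit (E t).det) :
    (Matrix.of fun s t : ZMod T => if t = s then E s else 0) *
        (1 + Matrix.of fun s t : ZMod T => if t = s + 1 then (E s)⁻¹ * F s else 0) =
      (Matrix.of fun s t : ZMod T => if t = s then E s else 0) +
        Matrix.of fun s t : ZMod T => if t = s + 1 then F s else 0 := by
  refine Matrix.ext fun s t => ?_
  simp only [Matrix.mul_apply, Matrix.add_apply, Matrix.of_apply, Matrix.one_apply, ite_mul,
    zero_mul, Finset.sum_ite_eq', Finset.mem_univ, if_true]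
  simp only [mul_add, mul_ite, mul_one, mul_zero, Matrix.mul_nonsing_inv_cancel_left _ _ (hE s)]
  by_cases hst : s = t
  · subst hst
    simp
  · rw [if_neg hst, if_neg (Ne.symm hst)]

end Cyclic

end BlockCyclicDet

open BlockCyclicDet in
/-- **Determinant of the identity plus a weighted block cyclic shift** (stub
`det_one_add_blockShift` of line `Sketch`, F3-core brick): for `T ≥ 1` and blocks
`N_t ∈ M_k(ℂ)`, `t ∈ ℤ/T`, the `(ℤ/T × k)`-matrix with identity diagonal blocks and blocks `N_t`
at `(t, t + 1)` (cyclically) has determinant `det (1 - (-1)^T N_0 N_1 ⋯ N_{T-1})`. -/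
theorem det_one_add_blockShift :
    ∀ (T : ℕ) [NeZero T] (k : Type) [Fintype k] [DecidableEq k] (N : ZMod T → Matrix k k ℂ),
      (1 + Matrix.of fun p q : ZMod T × k => if q.1 = p.1 + 1 then N p.1 p.2 q.2 else 0).det =
        (1 - (-1 : ℂ) ^ T • ((List.range T).map fun i : ℕ => N (i : ZMod T)).prod).det := by
  intro T _ k _ _ N
  have h1 : (Matrix.of fun p q : ZMod T × k => if q.1 = p.1 + 1 then N p.1 p.2 q.2 else 0) =
      Matrix.comp (ZMod T) (ZMod T) k k ℂ
        (Matrix.of fun s t : ZMod T => if t = s + 1 then N s else 0) := by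
    ext p q
    simp only [Matrix.comp_apply, Matrix.of_apply, ite_zero_apply]
  rw [h1, det_one_add_comp_shift]

open BlockCyclicDet in
/-- **Block-bidiagonal cyclic determinant** (stub `det_blockDiag_add_blockShift` of line
`Sketch`): for blockwise invertible diagonal blocks `E_t` and super-diagonal blocks `F_t` at
`(t, t + 1)` (cyclically in `t ∈ ℤ/T`),
`det D = ∏_t det E_t · det (1 - (-1)^T ∏_t E_t⁻¹ F_t)` (ordered product, increasing `t`). -/
theorem det_blockDiag_add_blockShift :
    ∀ (T : ℕ) [NeZero T] (k : Type) [Fintype k] [DecidableEq k] (E F : ZMod T → Matrix k k ℂ),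
      (∀ t, IsUnit (E t).det) →
        (Matrix.of fun p q : ZMod T × k =>
            (if q.1 = p.1 then E p.1 p.2 q.2 else 0) +
              (if q.1 = p.1 + 1 then F p.1 p.2 q.2 else 0)).det =
          (∏ t, (E t).det) *
            (1 - (-1 : ℂ) ^ T •
              ((List.range T).map fun i : ℕ => (E (i : ZMod T))⁻¹ * F (i : ZMod T)).prod).det := by
  intro T _ k _ _ E F hE
  have h1 : (Matrix.of fun p q : ZMod T × k =>
      (if q.1 = p.1 then E p.1 p.2 q.2 else 0) + (if q.1 = p.1 + 1 then F p.1 p.2 q.2 else 0)) =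
      Matrix.comp (ZMod T) (ZMod T) k k ℂ
        ((Matrix.of fun s t : ZMod T => if t = s then E s else 0) +
          Matrix.of fun s t : ZMod T => if t = s + 1 then F s else 0) := by
    ext p q
    simp only [Matrix.comp_apply, Matrix.add_apply, Matrix.of_apply, ite_zero_apply]
  rw [h1, ← diag_mul_one_add_shift E F hE, comp_mul', Matrix.det_mul, det_comp_diag, comp_add',
    Matrix.comp_one, det_one_add_comp_shift]

end Summit.QuantumFields.QCD.Cruxes.StableActionBridge.Sketch

end
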